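import Summits.HodgeConjecture.HodgeConjecture.Theorems.Ring2WeilCoverageTypeNormSignPrincipal
import Summits.HodgeConjecture.HodgeConjecture.Theorems.Ring2WeilCoverageCyclotomicSignaturesG12B
import Summits.HodgeConjecture.HodgeConjecture.Theorems.Ring2WeilCoverageCMTypeSetOddPositions
import HarnessLib

/-!
# Weil-type family coverage — THE NORM-SIGN LAW AT THE YES LEVELS 52 (THEOREM L (ii) only): on every census row
# `(ℚ(ζ_M), K)` at these levels, EVERY principal type `(ϖ₀)` with `N_{ℚ(ζ_M)⁺/ℚ}(ϖ₀) > 0` is carried by every `K`-balanced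
# point `ℂ^Φ/Φ(ℤ[ζ_M])`

research route conditional on HC_CM; not a corollary; Q11.4-sentence-2 already refuted in dim ≥ 3.

Ring 2, WEIL-TYPE FAMILY-COVERAGE CENSUS (`HOME/WEIL-FAMILY-COVERAGE.md` `## b01`, blocks b01.36–b01.41; owner ring2-b01), part 56g
of the `Ring2WeilCoverage*` series: the level files of part 55/55b (`…TypeNormSign`, `…TypeNormSignPrincipal`) at the levels
`M ∈ {52}` (`g = 12`, `h(ℚ(ζ₅₂)) = 3`), where all census rows are YES rows (an `ι`-compatible PRINCIPAL polarisation exists on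
every `K`-balanced `ℂ^Φ/Φ(ℤ[ζ_M])`, b01.36) and THEOREM L (ii) (`exists_units_sign_eq_M`: every even sign pattern is a unit
pattern) is a hypothesis-free tree theorem, but THEOREM L (i) (positivity of the norms of the units of `ℤ[ζ_M]⁺`) is not in
the tree.  Part 55b's one-hypothesis half `exists_type_span_of_even_iff` then gives the EXISTENCE direction of the norm-sign
law, for every real `ϖ₀ ∈ 𝓞 K⁺` at once: rows `(52, ℚ(i))`, `(52, ℚ(√−13))` — **`N_{K⁺/ℚ}(ϖ₀) > 0` ⇒ type `(ϖ₀)` occurs** (degree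
`N_{K⁺/ℚ}(ϖ₀)`), the principal verdict of a `K`-balanced `Φ` being the residue bit `n₋(M, K) = #{t ∈ N_K : 2t < M} ≡ 0` (part 5′
`card_inter_nodd_mod_two_eq`).  The converse («no type of negative norm») is NOT claimed at these levels.

Theorems:
* `exists_type_of_norm_pos_fiftyTwo_sqrt_neg_one`
* `exists_type_of_norm_pos_fiftyTwo_sqrt_neg_thirteen`

HONEST FRAMING: torus-level statements about Shimura's divisors of type `(K; Φ; 𝔣₀)` [Sh98 §14.3 Prop. 4–5] on
`ℂ^Φ/Φ(ℤ[ζ_M])` and norms of elements of `ℚ(ζ_M)⁺`; nothing here is a statement about Hodge classes, `W_K`, general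
members or HC; `HC_CM` is used nowhere.  No `def`, no named fact, no `sorry`.

References: [cite: Shimura1998, §14.3 Prop. 4–5, pp. 103–104]; census b01.36 / b01.41 (seat-derived).
-/

noncomputable section

open Polynomial NumberField Complex Finset
open scoped Real nonZeroDivisors

namespace Summit.HodgeConjecture.Ring2WeilCoverage.TypeNormSignLevel52

open Literature.AlgebraicGeometry.Motives (CMType)
open Literature.AlgebraicGeometry.HodgeTheory (IsCMTypeSet)
open Literature.AlgebraicGeometry.ComplexMultiplication.CyclotomicCMType (isCMTypeSet_residueFilter)
open Literature.NumberTheory.ComplexMultiplication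
open Summit.HodgeConjecture.Ring2WeilCoverage.TypeNormSign
open Summit.HodgeConjecture.Ring2WeilCoverage.CMTypeSetOddPositions (card_inter_nodd_mod_two_eq)
open Summit.HodgeConjecture.Ring2WeilCoverage.CyclotomicSignaturesG12B (exists_units_sign_eq_fiftyTwo)

variable {K : Type} [Field K] [NumberField K] {ζ : K}

/-- `𝐞(t) = exp(2πi t/n) ∈ ℂ` (`ZMod.toCircle`). -/
local notation3 (prettyPrint := false) "𝐞 " t:max => ((ZMod.toCircle t : Circle) : ℂ)

/-! ### Level `52` (`g = 24`) -/

section Level52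

/-- the residue set `S_Φ` read at level `52`. -/
local notation3 (prettyPrint := false) "SΦ52[" Φ "," z "]" =>
  (Finset.univ.filter fun t : ZMod 52 => ∃ σ ∈ (Φ : CMType K).1, σ (z : K) = 𝐞 t)

open scoped Classical in
/-- **CENSUS ROW `(ℚ(ζ_52), ℚ(i))` (a YES row) — EVERY TYPE OF POSITIVE NORM OCCURS.**  For every CM type `Φ` of `ℚ(ζ_52)`
balanced for `N_K = [3, 7, 11, 15, 19, 23, 27, 31, 35, 43, 47, 51]` (the Weil signature `(12,12)` on `K = ℚ(i)`) and every real integer `ϖ₀ ∈ 𝓞 K⁺` with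
`N_{K⁺/ℚ}(ϖ₀) > 0`: the principal CM torus `ℂ^Φ/Φ(ℤ[ζ_52])` carries a `Φ`-positive divisor of type `(K; Φ; (ϖ₀))` (an
`ι`-compatible polarisation of degree `N_{K⁺/ℚ}(ϖ₀)`).  THEOREM L (ii) at `52` only (part 55b `exists_type_span_of_even_iff`)
+ `|S_Φ ∩ N_odd| ≡ n₋ = 6 ≡ 0` (part 5′); the converse (nothing of negative norm) would need THEOREM L (i) at `52`,
not in the tree at this level (h = 3).
research route conditional on HC_CM; not a corollary; Q11.4-sentence-2 already refuted in dim ≥ 3. [cite: Shimura1998, §14.3 Prop. 4–5, pp. 103–104] -/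
theorem exists_type_of_norm_pos_fiftyTwo_sqrt_neg_one [IsCMField K] [IsCyclotomicExtension {52} ℚ K] (hζ : IsPrimitiveRoot ζ 52)
    (Φ : CMType K) (hbal : 2 * (SΦ52[Φ, ζ] ∩ ({3, 7, 11, 15, 19, 23, 27, 31, 35, 43, 47, 51} : Finset (ZMod 52))).card = (SΦ52[Φ, ζ]).card)
    {ϖ₀ : 𝓞 (maximalRealSubfield K)} (hpos : 0 < Algebra.norm ℚ ((ϖ₀ : maximalRealSubfield K))) :
    ∃ ζ' : K, IsCMField.complexConj K ζ' = -ζ' ∧ (∀ φ : Φ.1, 0 < (φ.1 ζ').im) ∧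
        CMTypeLattice.IsOfType (1 : (FractionalIdeal (𝓞 K)⁰ K)ˣ) ζ' (Ideal.span {ϖ₀}) := by
  have hg : Nat.totient 52 = 2 * (11 + 1) := by decide
  have hϖ0 : ϖ₀ ≠ 0 := by
    rintro rfl
    simp at hpos
  refine exists_type_span_of_even_iff hζ hg Φ hϖ0 (exists_units_sign_eq_fiftyTwo hζ Φ) ?_
  have hS := isCMTypeSet_residueFilter hζ Φ
  have hNK : IsCMTypeSet 52 ({3, 7, 11, 15, 19, 23, 27, 31, 35, 43, 47, 51} : Finset (ZMod 52)) := by decide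
  have h := card_inter_nodd_mod_two_eq (m := 52) (by norm_num) hS hNK hbal
  have hn : ((({3, 7, 11, 15, 19, 23, 27, 31, 35, 43, 47, 51} : Finset (ZMod 52))).filter fun t : ZMod 52 => 2 * t.val < 52).card % 2 = 0 := by
    decide
  rw [hn] at h
  exact ⟨fun _ => hpos, fun _ => Nat.even_iff.mpr h⟩

open scoped Classical in
/-- **CENSUS ROW `(ℚ(ζ_52), ℚ(√−13))` (a YES row) — EVERY TYPE OF POSITIVE NORM OCCURS.**  For every CM type `Φ` of `ℚ(ζ_52)`
balanced for `N_K = [3, 5, 21, 23, 27, 33, 35, 37, 41, 43, 45, 51]` (the Weil signature `(12,12)` on `K = ℚ(√−13)`) and every real integer `ϖ₀ ∈ 𝓞 K⁺` with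
`N_{K⁺/ℚ}(ϖ₀) > 0`: the principal CM torus `ℂ^Φ/Φ(ℤ[ζ_52])` carries a `Φ`-positive divisor of type `(K; Φ; (ϖ₀))` (an
`ι`-compatible polarisation of degree `N_{K⁺/ℚ}(ϖ₀)`).  THEOREM L (ii) at `52` only (part 55b `exists_type_span_of_even_iff`)
+ `|S_Φ ∩ N_odd| ≡ n₋ = 4 ≡ 0` (part 5′); the converse (nothing of negative norm) would need THEOREM L (i) at `52`,
not in the tree at this level (h = 3).
research route conditional on HC_CM; not a corollary; Q11.4-sentence-2 already refuted in dim ≥ 3. [cite: Shimura1998, §14.3 Prop. 4–5, pp. 103–104] -/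
theorem exists_type_of_norm_pos_fiftyTwo_sqrt_neg_thirteen [IsCMField K] [IsCyclotomicExtension {52} ℚ K] (hζ : IsPrimitiveRoot ζ 52)
    (Φ : CMType K) (hbal : 2 * (SΦ52[Φ, ζ] ∩ ({3, 5, 21, 23, 27, 33, 35, 37, 41, 43, 45, 51} : Finset (ZMod 52))).card = (SΦ52[Φ, ζ]).card)
    {ϖ₀ : 𝓞 (maximalRealSubfield K)} (hpos : 0 < Algebra.norm ℚ ((ϖ₀ : maximalRealSubfield K))) :
    ∃ ζ' : K, IsCMField.complexConj K ζ' = -ζ' ∧ (∀ φ : Φ.1, 0 < (φ.1 ζ').im) ∧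
        CMTypeLattice.IsOfType (1 : (FractionalIdeal (𝓞 K)⁰ K)ˣ) ζ' (Ideal.span {ϖ₀}) := by
  have hg : Nat.totient 52 = 2 * (11 + 1) := by decide
  have hϖ0 : ϖ₀ ≠ 0 := by
    rintro rfl
    simp at hpos
  refine exists_type_span_of_even_iff hζ hg Φ hϖ0 (exists_units_sign_eq_fiftyTwo hζ Φ) ?_
  have hS := isCMTypeSet_residueFilter hζ Φ
  have hNK : IsCMTypeSet 52 ({3, 5, 21, 23, 27, 33, 35, 37, 41, 43, 45, 51} : Finset (ZMod 52)) := by decide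
  have h := card_inter_nodd_mod_two_eq (m := 52) (by norm_num) hS hNK hbal
  have hn : ((({3, 5, 21, 23, 27, 33, 35, 37, 41, 43, 45, 51} : Finset (ZMod 52))).filter fun t : ZMod 52 => 2 * t.val < 52).card % 2 = 0 := by
    decide
  rw [hn] at h
  exact ⟨fun _ => hpos, fun _ => Nat.even_iff.mpr h⟩

end Level52

end Summit.HodgeConjecture.Ring2WeilCoverage.TypeNormSignLevel52

end
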